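import Literature.NumberTheory.Transcendental.BeukersZetaThreeIntegralsDiagProofs
import Literature.NumberTheory.Transcendental.AperyIrrationality
import HarnessLib

/-!
# Beukers' integrals for `ζ(3)` — proofs: the linear forms of Lemma 7.7.4

Fourth sibling proof file (D-0014) of
`Literature.NumberTheory.Transcendental.BeukersZetaThreeIntegrals`, after
`BeukersZetaThreeIntegralsProofs.lean` (`Beukers.tripleIntegral_zero_holds`),
`BeukersZetaThreeIntegralsOffDiagProofs.lean` (`Beukers.logKernelIntegral_offDiag_holds`) and
`BeukersZetaThreeIntegralsDiagProofs.lean` (`Beukers.logKernelIntegral_diag_holds` and the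
general expansion `Beukers.logKernelIntegral_eq_tsum`), all of which are reused here. It
DISCHARGES the named fact `Beukers.exists_int_linearForm` — G. E. Andrews, R. Askey, R. Roy,
*Special Functions* (CUP 1999), §7.7 "The irrationality of `ζ(3)`", Lemma 7.7.4, p. 392
(F. Beukers, Bull. London Math. Soc. 11 (1979) 268–272):

  there are integers `Aₙ, Bₙ` with
  `0 ≠ ∫₀¹∫₀¹ -log(xy)/(1-xy) pₙ(x)pₙ(y) dx dy = (Aₙ + Bₙζ(3)) dₙ⁻³`, `dₙ = lcm(1,…,n)`,

`pₙ = Polynomial.shiftedLegendre n`, as `Beukers.exists_int_linearForm_holds`.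

## The printed proof and this formalization

*The equality.* As printed: "Since `pₙ(x)` is a polynomial with integer coefficients, the
equality follows from Lemma 7.7.3" — here: bilinear expansion
`pₙ(x)pₙ(y) = ∑_{r,s≤n} c_r c_s xʳyˢ` over the integer coefficients `c_r` of
`Polynomial.shiftedLegendre n` and linearity of the integral (`legendreLogIntegral_eq_sum`; every
monomial term is integrable, `integrableOn_logKernel`, because its integral — a series of positive
terms by `logKernelIntegral_eq_tsum` — is nonzero), then Lemma 7.7.3 in its two cases
(`logKernelIntegral_diag_holds`, `logKernelIntegral_offDiag_holds`, and the symmetry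
`logKernelIntegral_symm` for `r < s`) with the arithmetic
`dₙ³ · (value) ∈ ℤ + [r = s]·2dₙ³ζ(3)` from `j ∣ dₙ`, `(r-s) ∣ dₙ` for `1 ≤ j, r-s ≤ n`
(`exists_int_diag`, `exists_int_offDiag`, `exists_int_lcm_mul_logKernelIntegral`).

*The nonvanishing `≠ 0`.* AAR derive it from the triple-integral identity (7.7.3) (the separate,
undischarged fact `legendreLogIntegral_eq_tripleIntegral`: two `n`-fold integrations by parts and a
substitution, "It is clear that the final integral is nonzero"). DEVIATION (a shorter road the
tree already provides): the expansion gives the explicit coefficient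
`Bₙ = 2dₙ³ ∑_r c_r² ≥ 2dₙ³ > 0` (`c₀ = 1`), so the vanishing of the integral would make
`ζ(3) = -Aₙ/Bₙ` rational, contradicting Apéry's theorem, which is PROVED in the tree
independently of Beukers' integrals (`Apery.irrational_zeta_three`, `AperyIrrationality.lean`,
via Apéry's recurrences). The statement discharged is exactly the vendored Lemma 7.7.4.

## References
* [AndrewsAskeyRoy1999] G. E. Andrews, R. Askey, R. Roy, Special Functions, CUP (1999), §7.7,
  Lemmas 7.7.3–7.7.4, pp. 391–392 (held: `book:andrews1999-special-functions`, PDF pp. 276–277).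
* [Beukers1979] F. Beukers, A note on the irrationality of `ζ(2)` and `ζ(3)`, Bull. London Math.
  Soc. 11 (1979) 268–272.
-/

noncomputable section

open MeasureTheory Set Polynomial Finset Filter

namespace Literature.NumberTheory.Transcendental

namespace Beukers

/-! ## §1 Consequences of the expansion of Lemma 7.7.3 -/

/-- Beukers' integrals are positive: `0 < ∫∫ -log(xy)/(1-xy) xʳyˢ` (all terms of the series
`logKernelIntegral_eq_tsum` are positive). [folklore] -/
theorem logKernelIntegral_pos (r s : ℕ) : 0 < logKernelIntegral r s := by
  rw [logKernelIntegral_eq_tsum]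
  exact (summable_integral_logKernel_terms r s).tsum_pos (fun k => by positivity) 0
    (by positivity)

/-- Each monomial against Beukers' kernel is integrable on the open unit square (its Bochner
integral is nonzero). [folklore] -/
theorem integrableOn_logKernel (r s : ℕ) :
    IntegrableOn (fun p : Fin 2 → ℝ =>
        -Real.log (p 0 * p 1) / (1 - p 0 * p 1) * (p 0 ^ r * p 1 ^ s))
      {p : Fin 2 → ℝ | ∀ i, p i ∈ Ioo (0 : ℝ) 1} volume := by
  have h := (logKernelIntegral_pos r s).ne'
  unfold logKernelIntegral at h
  exact Integrable.of_integral_ne_zero h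

/-- The kernel integral is symmetric, `L(r, s) = L(s, r)` (its series is). [folklore] -/
theorem logKernelIntegral_symm (r s : ℕ) : logKernelIntegral r s = logKernelIntegral s r := by
  rw [logKernelIntegral_eq_tsum, logKernelIntegral_eq_tsum]
  exact tsum_congr fun k => by ring

/-! ## §2 Lemma 7.7.4: the linear form in `1, ζ(3)` -/

/-- **Bilinear expansion** ("since `pₙ(x)` is a polynomial with integer coefficients"):
`∫∫ K pₙ(x)pₙ(y) = ∑_{r,s≤n} c_r c_s ∫∫ K xʳyˢ`, `c_r = ` the (integer) coefficients of
`Polynomial.shiftedLegendre n`. [cite: AndrewsAskeyRoy1999, Lemma 7.7.4 (proof)] -/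
theorem legendreLogIntegral_eq_sum (n : ℕ) :
    legendreLogIntegral n = ∑ r ∈ Finset.range (n + 1), ∑ s ∈ Finset.range (n + 1),
      ((shiftedLegendre n).coeff r : ℝ) * ((shiftedLegendre n).coeff s : ℝ) *
        logKernelIntegral r s := by
  unfold legendreLogIntegral logKernelIntegral
  have hpt : ∀ p : Fin 2 → ℝ,
      -Real.log (p 0 * p 1) / (1 - p 0 * p 1) *
          (aeval (p 0) (shiftedLegendre n) * aeval (p 1) (shiftedLegendre n)) =
        ∑ r ∈ Finset.range (n + 1), ∑ s ∈ Finset.range (n + 1),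
          ((shiftedLegendre n).coeff r : ℝ) * ((shiftedLegendre n).coeff s : ℝ) *
            (-Real.log (p 0 * p 1) / (1 - p 0 * p 1) * (p 0 ^ r * p 1 ^ s)) := by
    intro p
    rw [aeval_eq_sum_range, aeval_eq_sum_range, natDegree_shiftedLegendre, Finset.sum_mul_sum,
      Finset.mul_sum]
    refine Finset.sum_congr rfl fun r _ => ?_
    rw [Finset.mul_sum]
    refine Finset.sum_congr rfl fun s _ => ?_
    rw [zsmul_eq_mul, zsmul_eq_mul]
    ring
  simp_rw [hpt]
  rw [integral_finsetSum _ fun r _ => ?_]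
  · refine Finset.sum_congr rfl fun r _ => ?_
    rw [integral_finsetSum _ fun s _ => ?_]
    · refine Finset.sum_congr rfl fun s _ => ?_
      exact integral_const_mul _ _
    · exact (integrableOn_logKernel r s).const_mul _
  · exact integrable_finsetSum _ fun s _ => (integrableOn_logKernel r s).const_mul _

/-- Arithmetic of the diagonal terms: for `r ≤ n`,
`dₙ³ · 2(ζ(3) - ∑_{k<r} (k+1)⁻³) = A + 2dₙ³ζ(3)` with `A = -2∑_{k<r} (dₙ/(k+1))³ ∈ ℤ`.
[cite: AndrewsAskeyRoy1999, Lemma 7.7.4 (proof)] -/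
theorem exists_int_diag {n r : ℕ} (hr : r ≤ n) :
    ∃ A : ℤ, (Nat.lcmUpto n : ℝ) ^ 3 *
        (2 * (zetaValue 3 - ∑ k ∈ Finset.range r, 1 / ((k : ℝ) + 1) ^ 3)) =
      A + 2 * (Nat.lcmUpto n : ℝ) ^ 3 * zetaValue 3 := by
  -- `(k+1) ∣ dₙ` for `k < r ≤ n` (`Nat.lcmUpto n = (Finset.Icc 1 n).lcm id`)
  have he : ∀ k ∈ Finset.range r, ∃ e : ℕ, Nat.lcmUpto n = (k + 1) * e := fun k hk =>
    Finset.dvd_lcm (Finset.mem_Icc.2 ⟨Nat.succ_pos k, (Finset.mem_range.1 hk).trans_le hr⟩)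
  choose! e he using he
  refine ⟨-2 * ∑ k ∈ Finset.range r, (e k : ℤ) ^ 3, ?_⟩
  have hS : (Nat.lcmUpto n : ℝ) ^ 3 * ∑ k ∈ Finset.range r, 1 / ((k : ℝ) + 1) ^ 3 =
      ∑ k ∈ Finset.range r, (e k : ℝ) ^ 3 := by
    rw [Finset.mul_sum]
    refine Finset.sum_congr rfl fun k hk => ?_
    have hd : (Nat.lcmUpto n : ℝ) = ((k : ℝ) + 1) * e k := by exact_mod_cast he k hk
    have hk0 : (k : ℝ) + 1 ≠ 0 := by positivity
    rw [hd]
    field_simp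
  push_cast
  linear_combination (-2 : ℝ) * hS

/-- Arithmetic of the off-diagonal terms: for `s < r ≤ n`,
`dₙ³ · (∑_{s<j≤r} j⁻²)/(r-s) = ∑_j (dₙ/(r-s))(dₙ/j)² ∈ ℤ`.
[cite: AndrewsAskeyRoy1999, Lemma 7.7.3 ("denominator divides `d_r³`")] -/
theorem exists_int_offDiag {n r s : ℕ} (hr : r ≤ n) (h : s < r) :
    ∃ A : ℤ, (Nat.lcmUpto n : ℝ) ^ 3 *
        ((∑ j ∈ Finset.Ioc s r, 1 / (j : ℝ) ^ 2) / ((r : ℝ) - s)) = A := by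
  -- `(r-s) ∣ dₙ` and `j ∣ dₙ` for `s < j ≤ r ≤ n` (`Nat.lcmUpto n = (Finset.Icc 1 n).lcm id`)
  obtain ⟨c, hc⟩ : (r - s) ∣ Nat.lcmUpto n :=
    Finset.dvd_lcm (Finset.mem_Icc.2 ⟨Nat.sub_pos_of_lt h, (Nat.sub_le r s).trans hr⟩)
  have he : ∀ j ∈ Finset.Ioc s r, ∃ e : ℕ, Nat.lcmUpto n = j * e := fun j hj =>
    Finset.dvd_lcm (Finset.mem_Icc.2
      ⟨Nat.succ_le_of_lt (Nat.zero_lt_of_lt (Finset.mem_Ioc.1 hj).1),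
        (Finset.mem_Ioc.1 hj).2.trans hr⟩)
  choose! e he using he
  refine ⟨∑ j ∈ Finset.Ioc s r, (c : ℤ) * (e j : ℤ) ^ 2, ?_⟩
  have hrs : ((r : ℝ) - s) = ((r - s : ℕ) : ℝ) := by
    push_cast [Nat.cast_sub h.le]
    ring
  have hd1 : (Nat.lcmUpto n : ℝ) = ((r : ℝ) - s) * c := by
    rw [hrs]
    exact_mod_cast hc
  have hd0 : (0 : ℝ) < (r : ℝ) - s := sub_pos.2 (by exact_mod_cast h)
  rw [mul_div_assoc', Finset.mul_sum, Finset.sum_div]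
  push_cast
  refine Finset.sum_congr rfl fun j hj => ?_
  have hj0 : (0 : ℝ) < j := by exact_mod_cast Nat.zero_lt_of_lt (Finset.mem_Ioc.1 hj).1
  have hd2 : (Nat.lcmUpto n : ℝ) = (j : ℝ) * e j := by exact_mod_cast he j hj
  rw [show (Nat.lcmUpto n : ℝ) ^ 3 = ((r : ℝ) - s) * c * ((j : ℝ) * e j) ^ 2 by
    rw [← hd2, ← hd1]; ring]
  field_simp

/-- For `r, s ≤ n`: `dₙ³ · L(r,s) = A_{rs} + [r = s] · 2dₙ³ ζ(3)` with `A_{rs} ∈ ℤ`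
(Lemma 7.7.3 with the divisibilities `j ∣ dₙ`, `(r-s) ∣ dₙ`; the case `r < s` by symmetry).
[cite: AndrewsAskeyRoy1999, Lemma 7.7.4 (proof)] -/
theorem exists_int_lcm_mul_logKernelIntegral {n r s : ℕ} (hr : r ≤ n) (hs : s ≤ n) :
    ∃ A : ℤ, (Nat.lcmUpto n : ℝ) ^ 3 * logKernelIntegral r s =
      A + (if r = s then 2 * (Nat.lcmUpto n : ℝ) ^ 3 else 0) * zetaValue 3 := by
  rcases lt_trichotomy s r with h | h | h
  · obtain ⟨A, hA⟩ := exists_int_offDiag hr h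
    refine ⟨A, ?_⟩
    rw [if_neg h.ne', zero_mul, add_zero, logKernelIntegral_offDiag_holds r s h, hA]
  · subst h
    obtain ⟨A, hA⟩ := exists_int_diag hs
    refine ⟨A, ?_⟩
    rw [if_pos rfl, logKernelIntegral_diag_holds s, hA]
  · obtain ⟨A, hA⟩ := exists_int_offDiag hs h
    refine ⟨A, ?_⟩
    rw [if_neg h.ne, zero_mul, add_zero, logKernelIntegral_symm,
      logKernelIntegral_offDiag_holds s r h, hA]

/-- **Discharge of `exists_int_linearForm`** (AAR Lemma 7.7.4; Beukers 1979): there are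
integers `Aₙ, Bₙ` with `∫₀¹∫₀¹ -log(xy)/(1-xy) pₙ(x)pₙ(y) dx dy = (Aₙ + Bₙζ(3)) dₙ⁻³ ≠ 0`.
Equality: bilinear expansion + Lemma 7.7.3 + `dₙ`-arithmetic, as printed. Nonvanishing: here
from `Bₙ = 2dₙ³∑c_r² > 0` and the irrationality of `ζ(3)` proved in the tree
(`Apery.irrational_zeta_three`) — see the module docstring for this deviation from the printed
route through (7.7.3). [cite: AndrewsAskeyRoy1999, Lemma 7.7.4] -/
theorem exists_int_linearForm_holds : exists_int_linearForm := by
  intro n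
  classical
  set d : ℝ := (Nat.lcmUpto n : ℝ) with hd
  set c : ℕ → ℤ := fun r => (shiftedLegendre n).coeff r with hc
  have hdpos : 0 < d := by
    rw [hd]
    exact_mod_cast Nat.lcmUpto_pos n
  have hA : ∀ r ∈ Finset.range (n + 1), ∀ s ∈ Finset.range (n + 1), ∃ A : ℤ,
      d ^ 3 * logKernelIntegral r s = A + (if r = s then 2 * d ^ 3 else 0) * zetaValue 3 :=
    fun r hr s hs => exists_int_lcm_mul_logKernelIntegral
      (Nat.lt_succ_iff.1 (Finset.mem_range.1 hr)) (Nat.lt_succ_iff.1 (Finset.mem_range.1 hs))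
  choose! A hA using hA
  -- the integers `Aₙ = ∑ c_r c_s A_{rs}`, `Bₙ = 2 dₙ³ ∑ c_r²`
  set A' : ℤ := ∑ r ∈ Finset.range (n + 1), ∑ s ∈ Finset.range (n + 1), c r * c s * A r s
    with hA'
  set B' : ℤ := 2 * (Nat.lcmUpto n : ℤ) ^ 3 * ∑ r ∈ Finset.range (n + 1), c r ^ 2 with hB'
  have hB'cast : (B' : ℝ) = 2 * d ^ 3 * ∑ r ∈ Finset.range (n + 1), (c r : ℝ) ^ 2 := by
    rw [hB', hd]
    push_cast
    ring
  have key : d ^ 3 * legendreLogIntegral n = (A' : ℝ) + (B' : ℝ) * zetaValue 3 := by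
    rw [legendreLogIntegral_eq_sum, Finset.mul_sum, hA', hB'cast]
    have h1 : ∀ r ∈ Finset.range (n + 1),
        d ^ 3 * ∑ s ∈ Finset.range (n + 1), (c r : ℝ) * (c s : ℝ) * logKernelIntegral r s =
          (∑ s ∈ Finset.range (n + 1), ((c r * c s * A r s : ℤ) : ℝ)) +
            2 * d ^ 3 * (c r : ℝ) ^ 2 * zetaValue 3 := by
      intro r hr
      rw [Finset.mul_sum]
      have h2 : ∀ s ∈ Finset.range (n + 1),
          d ^ 3 * ((c r : ℝ) * (c s : ℝ) * logKernelIntegral r s) =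
            ((c r * c s * A r s : ℤ) : ℝ) +
              (if r = s then 2 * d ^ 3 * (c r : ℝ) ^ 2 * zetaValue 3 else 0) := by
        intro s hs
        have h := hA r hr s hs
        push_cast
        split_ifs with hrs
        · subst hrs
          rw [if_pos rfl] at h
          linear_combination (c r : ℝ) * (c r : ℝ) * h
        · rw [if_neg hrs] at h
          linear_combination (c r : ℝ) * (c s : ℝ) * h
      rw [Finset.sum_congr rfl h2, Finset.sum_add_distrib, Finset.sum_ite_eq, if_pos hr]
    rw [Finset.sum_congr rfl h1, Finset.sum_add_distrib]
    push_cast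
    rw [Finset.mul_sum, Finset.sum_mul]
  have hd3 : d ^ 3 ≠ 0 := pow_ne_zero 3 hdpos.ne'
  refine ⟨A', B', ?_, ?_⟩
  · rw [eq_div_iff hd3, mul_comm, key]
  · -- `Bₙ ≥ 2dₙ³ > 0` (`c₀ = 1`), so vanishing would make `ζ(3)` rational
    intro h0
    have hc0 : (c 0 : ℝ) ^ 2 = 1 := by
      simp [hc, coeff_shiftedLegendre]
    have hsum : (1 : ℝ) ≤ ∑ r ∈ Finset.range (n + 1), (c r : ℝ) ^ 2 := by
      rw [← hc0]
      exact Finset.single_le_sum (f := fun r => (c r : ℝ) ^ 2) (fun r _ => sq_nonneg _)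
        (Finset.mem_range.2 (Nat.succ_pos n))
    have hBpos : (0 : ℝ) < B' := by
      rw [hB'cast]
      have : 0 < d ^ 3 := pow_pos hdpos 3
      nlinarith
    have hB0 : B' ≠ 0 := by exact_mod_cast hBpos.ne'
    have hzeta : zetaValue 3 = ((-A' : ℤ) : ℝ) / ((B' : ℤ) : ℝ) := by
      rw [eq_div_iff hBpos.ne']
      have : (A' : ℝ) + (B' : ℝ) * zetaValue 3 = 0 := by rw [← key, h0, mul_zero]
      push_cast
      linarith
    exact (irrational_iff_ne_rational _).1 Apery.irrational_zeta_three (-A') B' hB0 hzeta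

end Beukers

end Literature.NumberTheory.Transcendental
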